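import Summits.QuantumFields.QCD.Theorems.SpectralDefectExtinctionWindowExtinctionChessboardDeepAsymptotics
import Summits.QuantumFields.QCD.Theorems.TipPricing.Negative.ReflectionSimilarity
import Summits.QuantumFields.QCD.Theorems.TipPricing.Negative.FreeSideObligation
import Summits.QuantumFields.QCD.Theorems.SpectralDefectExtinctionTipNoBindingFreeSymbol
import Summits.QuantumFields.QCD.Theorems.WindowExtinction.Negative.SpectralFlowLocal
import Literature.Barriers.QuantumFields.WilsonDeterminantMassSplitting
import Literature.Probability.LatticeModels.TorusFourierProofs

/-!
# Kato line, S3 audit fragment: the trivial gauge field has ZERO spectral index throughout the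
# physical probe range — no pathwise route to TIGHT

Line `kato-radius-collective-defects` of crux `SpectralDefectExtinction.WindowExtinction`
(item stmt-QuantumFields-8964), stub S3 `stub_pinnedTightEdge` (open: BOTTOM ∧ TIGHT for a pinned,
volume-capped witness).  TIGHT asks, eventually in `k` and for every probe depth `M > M₀`, for
`E₊ |n₋(Γ₅ D_W(U, m_crit(k) − a_k M/Z_k, 1)) − 6(2L_k+1)⁴| ≥ 1` (phase-quenched mean on the scheme torus).
Off the Wilson hole (`probe > 0` or `< −8`) the integrand vanishes for EVERY field (chiral inertia,
`negCount_hermitianWilson_eq`); the pins of S3 put the probe INSIDE `[−8, 0)`, where the index is field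
dependent.  This file closes the remaining "deterministic corner": at the trivial field `U = 1` the index
vanishes at EVERY probe `m ∈ [−1, 0)`, on EVERY torus —

* `freeSymbol_sq_ge_sq` — the free symbol of `D_W(1,0,1) − t` has `|symbol|² ≥ t²` for `t ≤ 1`;
* `wilsonDirac_one_sub_eq_zero` — hence `D_W(1,0,1) − t` is injective for `0 < t ≤ 1` (torus Fourier +
  Plancherel), and `det D_W(1, m, 1) ≠ 0` for `m ∈ [−1, 0)` (`det_wilsonDirac_one_ne_zero`);
* `kato_freeField_negCount_eq_half` — `n₋(Γ₅ D_W(1, m, 1)) = 6 L⁴` for `m ∈ [−1, 0)`: the time reflection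
  `Θ'` fixes `U = 1` and exchanges `n₋ ↔ n₊` (`negCount_hermitianWilson_negReflect`), and there is no zero
  mode;
* `kato_noPathwiseTight` — consequently, along ANY mass-scaling, asymptotically scaling regularisation whose
  level is pinned at the `g₀²` scale (`cE ≤ −m_crit(k) β_k ≤ CE`, the PINS of S2a/S2b/S3) and for every probe
  depth `M ≥ 0`, the TIGHT integrand VANISHES at `U = 1` eventually in `k`.  So TIGHT for the S3 witness class
  is never a pathwise (configuration-wise) inequality: it is a statement about the Wilson measure at weak
  coupling giving weight to topologically non-trivial fields (`E₊|Q| ≥ 1` on the capped scheme torus) —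
  the open content recorded in the lead's notes.
-/

noncomputable section

namespace Summit.QuantumFields.QCD.Cruxes.WindowExtinction.KatoRadiusCollectiveDefects

open scoped BigOperators Topology
open Filter Matrix
open Literature.MathematicalPhysics.QuantumLattice Literature.MathematicalPhysics.QuantumFieldTheory
  Literature.Probability.LatticeModels
open Summit.QuantumFields.QCD.Cruxes.TipNoBinding.PositivityNoLeakSpread
  (sum_norm_sq_torusFourier_free_sub)
open Summit.QuantumFields.QCD.Theorems.TipPricing.Negative
  (negCount_hermitianWilson_negReflect tendsto_a_div_Zm)
open Summit.QuantumFields.QCD.Theorems.WindowExtinction.Negative (countP_neg_add_pos_add_zero)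
open Summit.QuantumFields.QCD.Cruxes.WindowExtinction.ChessboardColdCells (deep_tendsto_beta_atTop)

/-- The colour group. -/
local notation "SU3" => Matrix.specialUnitaryGroup (Fin 3) ℂ

/-! ## The free symbol is bounded below by the probe -/

/-- **`|symbol|² ≥ t²` for `t ≤ 1`**: with `w_μ = 1 − cos θ_μ ∈ [0, 2]` and `sin² θ_μ = w_μ (2 − w_μ)`,
`(Σ_μ w_μ − t)² + Σ_μ sin² θ_μ = t² + 2(1 − t) Σ_μ w_μ + Σ_{μ ≠ ν} w_μ w_ν ≥ t²`. -/
theorem freeSymbol_sq_ge_sq {L : ℕ} (t : ℝ) (ht : t ≤ 1) (k : TorusSite 4 L) :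
    t ^ 2 ≤ ((∑ μ, (1 - Real.cos (2 * Real.pi * ((k μ).val : ℝ) / L))) - t) ^ 2 +
        ∑ μ, Real.sin (2 * Real.pi * ((k μ).val : ℝ) / L) ^ 2 := by
  have hw0 : ∀ μ : Fin 4, 0 ≤ 1 - Real.cos (2 * Real.pi * ((k μ).val : ℝ) / L) := fun μ =>
    sub_nonneg.mpr (Real.cos_le_one _)
  have hs : ∀ μ : Fin 4, Real.sin (2 * Real.pi * ((k μ).val : ℝ) / L) ^ 2 =
      (1 - Real.cos (2 * Real.pi * ((k μ).val : ℝ) / L)) *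
        (2 - (1 - Real.cos (2 * Real.pi * ((k μ).val : ℝ) / L))) := fun μ => by
    rw [Real.sin_sq]; ring
  simp only [Fin.sum_univ_four, hs]
  set a := 1 - Real.cos (2 * Real.pi * ((k 0).val : ℝ) / L)
  set b := 1 - Real.cos (2 * Real.pi * ((k 1).val : ℝ) / L)
  set c := 1 - Real.cos (2 * Real.pi * ((k 2).val : ℝ) / L)
  set d := 1 - Real.cos (2 * Real.pi * ((k 3).val : ℝ) / L)
  have ha := hw0 0; have hb := hw0 1; have hc := hw0 2; have hd := hw0 3
  have ht' : 0 ≤ 1 - t := by linarith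
  nlinarith [mul_nonneg ha hb, mul_nonneg ha hc, mul_nonneg ha hd, mul_nonneg hb hc, mul_nonneg hb hd,
    mul_nonneg hc hd, mul_nonneg ht' ha, mul_nonneg ht' hb, mul_nonneg ht' hc, mul_nonneg ht' hd]

/-! ## The free massless Wilson–Dirac operator has no real eigenvalue in `(0, 1]` -/

/-- **`D_W(1,0,1) − t` is injective for `0 < t ≤ 1`** (every torus): in torus Fourier variables the free
operator acts on each `(k, a)` block by a normal `4 × 4` symbol of squared modulus `≥ t² > 0`
(`sum_norm_sq_torusFourier_free_sub`, `freeSymbol_sq_ge_sq`), and the Fourier transform is injective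
(Plancherel, `torusFourier_plancherel_holds`). -/
theorem wilsonDirac_one_sub_eq_zero {L : ℕ} [NeZero L] {t : ℝ} (ht0 : 0 < t) (ht1 : t ≤ 1)
    {ψ : TorusSite 4 L × Fin 3 × Fin 4 → ℂ}
    (h : wilsonDirac (fundamentalRep (Fin 3)) (1 : GaugeConfig 4 L SU3) 0 1 *ᵥ ψ - (t : ℂ) • ψ = 0) :
    ψ = 0 := by
  -- every Fourier coefficient of every colour/spin component vanishes
  have hF : ∀ (k : TorusSite 4 L) (a : Fin 3) (α : Fin 4), torusFourier (fun x => ψ (x, a, α)) k = 0 := by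
    intro k a α
    have hq := sum_norm_sq_torusFourier_free_sub L ψ t k a
    rw [h] at hq
    have hzero : ∀ β : Fin 4, torusFourier (fun x => (0 : TorusSite 4 L × Fin 3 × Fin 4 → ℂ) (x, a, β)) k = 0 :=
      fun β => by simp [torusFourier]
    simp only [hzero, norm_zero, ne_eq, OfNat.ofNat_ne_zero, not_false_eq_true, zero_pow,
      Finset.sum_const_zero] at hq
    have hpos : 0 < ((∑ μ, (1 - Real.cos (2 * Real.pi * ((k μ).val : ℝ) / L))) - t) ^ 2 +
        ∑ μ, Real.sin (2 * Real.pi * ((k μ).val : ℝ) / L) ^ 2 :=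
      lt_of_lt_of_le (by positivity) (freeSymbol_sq_ge_sq t ht1 k)
    have hsum : ∑ β, ‖torusFourier (fun x => ψ (x, a, β)) k‖ ^ 2 = 0 := by
      rcases mul_eq_zero.1 hq.symm with h1 | h1
      · exact absurd h1 hpos.ne'
      · exact h1
    have hle : ‖torusFourier (fun x => ψ (x, a, α)) k‖ ^ 2 ≤
        ∑ β, ‖torusFourier (fun x => ψ (x, a, β)) k‖ ^ 2 :=
      Finset.single_le_sum (f := fun β => ‖torusFourier (fun x => ψ (x, a, β)) k‖ ^ 2)
        (fun β _ => by positivity) (Finset.mem_univ α)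
    rw [hsum] at hle
    have : ‖torusFourier (fun x => ψ (x, a, α)) k‖ ^ 2 = 0 := le_antisymm hle (by positivity)
    exact norm_eq_zero.1 (pow_eq_zero_iff two_ne_zero |>.1 this)
  -- Plancherel, component by component
  funext p
  obtain ⟨x, a, α⟩ := p
  have hP := torusFourier_plancherel_holds (d := 4) (L := L) (fun y => ψ (y, a, α))
  simp only [hF, norm_zero, ne_eq, OfNat.ofNat_ne_zero, not_false_eq_true, zero_pow,
    Finset.sum_const_zero] at hP
  have hL : (0 : ℝ) < (L : ℝ) ^ 4 := by
    have : (0 : ℝ) < L := by exact_mod_cast Nat.pos_of_ne_zero (NeZero.ne L)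
    positivity
  have hsum : ∑ y, ‖ψ (y, a, α)‖ ^ 2 = 0 := by
    rcases mul_eq_zero.1 hP.symm with h1 | h1
    · exact absurd h1 hL.ne'
    · exact h1
  have hx := (Finset.sum_eq_zero_iff_of_nonneg (fun y _ => by positivity)).1 hsum x (Finset.mem_univ x)
  exact norm_eq_zero.1 (pow_eq_zero_iff two_ne_zero |>.1 hx)

/-- **`det D_W(1, m, 1) ≠ 0` for `m ∈ [−1, 0)`** on every torus: the trivial field has no real mode of
the massless operator in `(0, 1]` (`wilsonDirac_one_sub_eq_zero` with `t = −m`). -/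
theorem det_wilsonDirac_one_ne_zero {L : ℕ} [NeZero L] {m : ℝ} (hm1 : -1 ≤ m) (hm0 : m < 0) :
    (wilsonDirac (fundamentalRep (Fin 3)) (1 : GaugeConfig 4 L SU3) m 1).det ≠ 0 := by
  intro hdet
  obtain ⟨ψ, hψ, hDψ⟩ := Matrix.exists_mulVec_eq_zero_iff.2 hdet
  apply hψ
  refine wilsonDirac_one_sub_eq_zero (t := -m) (by linarith) (by linarith) ?_
  rw [wilsonDirac_mass_eq_add_scalar (fundamentalRep (Fin 3)) (1 : GaugeConfig 4 L SU3) m 1,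
    add_mulVec, scalar_apply, ← smul_one_eq_diagonal, smul_mulVec, one_mulVec] at hDψ
  rw [Complex.ofReal_neg, neg_smul, sub_neg_eq_add]
  exact hDψ

/-! ## Zero index at the trivial field -/

/-- The time reflection `Θ'` fixes the trivial gauge field. -/
theorem negReflect_one {L : ℕ} : (1 : GaugeConfig 4 L SU3).negReflect = 1 := by
  funext e
  simp [GaugeConfig.negReflect]

/-- **Zero spectral index at the trivial field, throughout the physical probe range.**  For every torus
side `L ≥ 1` and every probe `m ∈ [−1, 0)`, exactly `6 L⁴` of the `12 L⁴` eigenvalues of the Hermitian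
Wilson–Dirac operator `Γ₅ D_W(1, m, 1)` are negative: the time reflection fixes `U = 1` and exchanges the
negative and positive counts (`negCount_hermitianWilson_negReflect`), and there is no zero eigenvalue
(`det_wilsonDirac_one_ne_zero`).  So the TIGHT integrand `|n₋ − 6(2L+1)⁴|` of `WindowExtinction` is NOT
bounded below by a positive constant inside the pinned probe range: it vanishes at `U = 1`. -/
theorem kato_freeField_negCount_eq_half :
    ∀ (L : ℕ) [NeZero L] (m : ℝ), -1 ≤ m → m < 0 →
      Multiset.countP (fun z : ℂ => z.re < 0)
          (spinorLift gammaFive * wilsonDirac (fundamentalRep (Fin 3))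
            (1 : GaugeConfig 4 L ↥(Matrix.specialUnitaryGroup (Fin 3) ℂ)) m 1).charpoly.roots = 6 * L ^ 4 := by
  intro L _ m hm1 hm0
  have hρ3 : ∀ g : SU3, fundamentalRep (Fin 3) g ∈ Matrix.unitaryGroup (Fin 3) ℂ :=
    fundamentalRep_mem_unitaryGroup
  set H := spinorLift gammaFive * wilsonDirac (fundamentalRep (Fin 3)) (1 : GaugeConfig 4 L SU3) m 1
    with hH_def
  have hH : H.IsHermitian :=
    Literature.Barriers.QuantumFields.isHermitian_gammaFive_mul_wilsonDirac (fundamentalRep (Fin 3))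
      hρ3 (1 : GaugeConfig 4 L SU3) m 1
  -- `n₋ = n₊` by the reflection symmetry at `U = 1`
  have hsymm : H.charpoly.roots.countP (fun z : ℂ => z.re < 0) =
      H.charpoly.roots.countP (fun z : ℂ => 0 < z.re) := by
    have h := negCount_hermitianWilson_negReflect (fundamentalRep (Fin 3)) hρ3 (1 : GaugeConfig 4 L SU3) m
    rwa [negReflect_one] at h
  -- no zero mode
  have hdetH : H.det ≠ 0 := by
    rw [hH_def, det_mul]
    refine mul_ne_zero ?_ (det_wilsonDirac_one_ne_zero hm1 hm0)
    intro h0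
    have h1 := congrArg Matrix.det (spinorLift_gammaFive_mul_self (L := L) (N := 3))
    rw [det_mul, det_one, h0, zero_mul] at h1
    exact zero_ne_one h1
  have hzero : H.charpoly.roots.countP (fun z : ℂ => z.re = 0) = 0 := by
    rw [Multiset.countP_eq_zero]
    intro z hz hre
    have hzim : z.im = 0 := by
      have hz2 := hz
      rw [hH.roots_charpoly_eq_eigenvalues, Multiset.mem_map] at hz2
      obtain ⟨i, -, rfl⟩ := hz2
      simp
    have hz0 : z = 0 := Complex.ext (by simpa using hre) (by simpa using hzim)
    have heval : (Matrix.scalar _ z - H).det = 0 := by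
      rw [← Matrix.eval_charpoly]
      exact (Polynomial.mem_roots (Matrix.charpoly_monic H).ne_zero).1 hz
    rw [hz0, map_zero, zero_sub, det_neg] at heval
    rcases mul_eq_zero.1 heval with h | h
    · exact absurd h (pow_ne_zero _ (neg_ne_zero.mpr one_ne_zero))
    · exact hdetH h
  -- trichotomy `n₋ + n₊ + n₀ = 12 L⁴`
  have htri := countP_neg_add_pos_add_zero hH
  rw [hzero, add_zero, ← hsymm, card_quarkIdx] at htri
  omega

/-! ## Consequence for S3's witness class: TIGHT is never pathwise -/

/-- **No pathwise TIGHT along pinned data.**  For `N_f ≤ 16` and ANY mass-scaling, asymptotically scaling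
regularisation whose level is pinned at the `g₀²` scale — `cE ≤ −m_crit(k) β_k ≤ CE` eventually,
`0 < cE ≤ CE` (the level pin of S2a/S2b/S3) — and every probe depth `M ≥ 0`, the TIGHT integrand
`|n₋(Γ₅ D_W(U, m_crit(k) − a_k M/Z_k, 1)) − 6(2L_k+1)⁴|` VANISHES at the trivial field `U = 1` on the scheme
torus, eventually in `k`: `β_k → ∞` (`deep_tendsto_beta_atTop`) and `a_k/Z_k → 0` (`tendsto_a_div_Zm`) put
the probe in `[−1, 0)`, where `kato_freeField_negCount_eq_half` applies.  Hence no configuration-wise lower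
bound can deliver TIGHT for the S3 class: its content is that the phase-quenched Wilson measure at `β_k`
gives total weight `≥ 1` (in first absolute moment) to fields of non-zero index on the capped torus. -/
theorem kato_noPathwiseTight :
    ∀ (Nf : ℕ), Nf ≤ 16 → ∀ (reg : QCDRegularisation Nf), reg.HasMassScaling →
      (reg.scheme 0 0 0).HasAsymptoticScaling →
      (∃ cE CE : ℝ, 0 < cE ∧ cE ≤ CE ∧ ∀ᶠ k : ℕ in Filter.atTop,
          cE ≤ -reg.mcrit k * reg.β k ∧ -reg.mcrit k * reg.β k ≤ CE) →
      ∀ M : ℝ, 0 ≤ M → ∀ᶠ k : ℕ in Filter.atTop,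
        |(Multiset.countP (fun z : ℂ => z.re < 0) (spinorLift gammaFive *
            wilsonDirac (fundamentalRep (Fin 3)) (1 : GaugeConfig 4 (2 * reg.L k + 1) ↥(Matrix.specialUnitaryGroup (Fin 3) ℂ))
              (reg.mcrit k - reg.a k * M / reg.Zm k) 1).charpoly.roots : ℝ) -
          6 * (2 * reg.L k + 1 : ℝ) ^ 4| = 0 := by
  intro Nf hNf reg hMS hAS hpin M hM
  obtain ⟨cE, CE, hcE, hCE, hev⟩ := hpin
  have hβ : Tendsto reg.β atTop atTop := deep_tendsto_beta_atTop hNf (reg.scheme 0 0 0) hAS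
  have haZ : Tendsto (fun k => reg.a k / reg.Zm k) atTop (𝓝 0) := tendsto_a_div_Zm hNf reg hMS
  have hβ2 : ∀ᶠ k : ℕ in atTop, 2 * CE ≤ reg.β k := hβ.eventually_ge_atTop _
  have haZ2 : ∀ᶠ k : ℕ in atTop, reg.a k / reg.Zm k < 1 / (2 * (M + 1)) :=
    haZ.eventually (gt_mem_nhds (by positivity))
  filter_upwards [hev, hβ2, haZ2] with k hk hβk haz
  have hCE0 : 0 < CE := lt_of_lt_of_le hcE hCE
  have hβ0 : 0 < reg.β k := by linarith
  -- the level: `−1/2 ≤ m_crit(k) < 0`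
  have hcrit0 : reg.mcrit k < 0 := by
    by_contra h
    push Not at h
    have : -reg.mcrit k * reg.β k ≤ 0 := by nlinarith
    linarith [hk.1]
  have hcrit1 : -(1 / 2 : ℝ) ≤ reg.mcrit k := by
    have h2 : -reg.mcrit k * reg.β k ≤ reg.β k / 2 := by linarith [hk.2]
    by_contra h
    push Not at h
    nlinarith
  -- the window: `0 ≤ a_k M / Z_k ≤ 1/2`
  have haZ0 : 0 ≤ reg.a k / reg.Zm k := div_nonneg (reg.a_pos k).le (reg.Zm_pos k).le
  have hw0 : 0 ≤ reg.a k * M / reg.Zm k := by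
    rw [mul_div_right_comm]; exact mul_nonneg haZ0 hM
  have hw1 : reg.a k * M / reg.Zm k ≤ 1 / 2 := by
    rw [mul_div_right_comm]
    have h1 : reg.a k / reg.Zm k * M ≤ 1 / (2 * (M + 1)) * M :=
      mul_le_mul_of_nonneg_right haz.le hM
    have h2 : 1 / (2 * (M + 1)) * M ≤ 1 / 2 := by
      rw [div_mul_eq_mul_div, one_mul, div_le_iff₀ (by positivity)]
      linarith
    exact h1.trans h2
  have hp1 : -1 ≤ reg.mcrit k - reg.a k * M / reg.Zm k := by linarith
  have hp0 : reg.mcrit k - reg.a k * M / reg.Zm k < 0 := by linarith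
  rw [kato_freeField_negCount_eq_half (2 * reg.L k + 1) _ hp1 hp0]
  push_cast
  simp

end Summit.QuantumFields.QCD.Cruxes.WindowExtinction.KatoRadiusCollectiveDefects

end
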